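import Mathlib
import Summits.ResolutionOfSingularities.ResolutionOfSingularities.Theses.PAlteration
import Summits.ResolutionOfSingularities.ResolutionOfSingularities.Theorems.PAlterationPicoverLocalModelCases
import Literature.AlgebraicGeometry.Resolution.ResolutionLocalization

/-!
# ResolutionOfSingularities / pAlteration — `PicoverLocalModel` over finitely generated fields
# from resolution over the PERFECT prime field (supports stmt-ResolutionOfSingularities-0557)

Route `pAlteration`, crux `PicoverLocalModel` (rank 5): for a prime `p`, a field `k` of
characteristic `p`, a regular finitely generated `k`-domain `R` and `a ∈ R`, the reduced local
model `X_a := Spec ((R[T]/(T^p - a))_red)` has a resolution.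

The crux quantifies over ALL fields `k` of characteristic `p`, in particular imperfect ones, while
the perfect-field programme of the sibling route `WeightedInvariant` (`WeightedThesis`,
`DescentPerfectToAll`) produces resolutions over PERFECT fields. This file records exactly how much
of the crux the perfect-field statements already cover, using the tree's localization lemma
`Literature.AlgebraicGeometry.Resolution.hasResolution_Spec_of_essFiniteType` ("resolutions
localize", EGA IV₃ §8):

* `hasResolution_Spec_of_finiteType_int_of_perfect` — resolution of reduced separated schemes of
  finite type over perfect fields of characteristic `p` (the hypothesis of `DescentPerfectToAll`,
  discharged by `WeightedThesis`; only `k = 𝔽_p` is used) resolves `Spec C` for every domain `C`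
  of characteristic `p` finitely generated over `ℤ` (i.e. over `𝔽_p`);
* `hasResolution_Spec_of_essFiniteType_int_of_perfect` — hence `Spec B` for every domain `B` of
  characteristic `p` ESSENTIALLY of finite type over `ℤ` (a localization of such a `C`): spread
  out and localize the resolution of the model;
* `picoverLocalModel_of_perfect_of_essFiniteType` — hence the crux for every ground field `k`
  finitely generated over `𝔽_p` (`Algebra.EssFiniteType ℤ k`: `k` is the fraction field of a
  finitely generated `𝔽_p`-domain), e.g. `k = 𝔽_p(t₁,…,t_m)`, in ALL dimensions —
  conditionally on resolution over the single perfect field `𝔽_p`;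
* `picoverLocalModel_of_perfect_of_perfectField` — and, trivially, for perfect `k`.

What remains of the crux beyond the perfect-field statements is therefore the case of ground
fields `k` NOT finitely generated over `𝔽_p` and imperfect (`[k : k^p] = ∞`, e.g.
`𝔽_p(t₁, t₂, …)`, or `𝔽_p((t))`), where descending a resolution from a finitely generated
subfield meets the barrier `Literature.Barriers.ResolutionOfSingularities.InseparableBaseChange`
(regularity is not stable under inseparable ground-field extension) — the same residue as the
crux `DescentPerfectToAll` (stmt-ResolutionOfSingularities-0549). No statement item is restated;
the antecedent `hP` below is the perfect-field hypothesis of `DescentPerfectToAll` at the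
prime `p`, verbatim.
-/

-- `Summit.<Summit>.<Sub>.Theorems` with `Sub = Summit` (single-conjunct summit, D-0017).
set_option linter.dupNamespace false

namespace Summit.ResolutionOfSingularities.ResolutionOfSingularities.Theorems

open Polynomial AlgebraicGeometry CategoryTheory Literature.AlgebraicGeometry.Resolution

section PerfectPrimeField

/-! Throughout this section `hP` is resolution of reduced separated schemes of finite type over
every PERFECT field of characteristic `p` — the hypothesis of the crux `DescentPerfectToAll` of
route `WeightedInvariant` at the prime `p` (and the conclusion of its `WeightedThesis` at `p`),
written inline (no new statement is introduced). Only the instance `k = ZMod p` is used. -/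

variable {p : ℕ} [hp : Fact p.Prime]
  (hP : ∀ (k : Type) [Field k] [CharP k p] [PerfectField k] (X : Scheme.{0})
    (f : X ⟶ Spec (.of k)), IsSeparated f → LocallyOfFiniteType f → QuasiCompact f →
      IsReduced X → Scheme.HasResolution X)

include hP

/-- **Resolution over the perfect prime field resolves every affine variety over `𝔽_p`**: under
`hP` (used only at `k = ZMod p`), `Spec C` has a resolution for every reduced
ring `C` of characteristic `p` of finite type over `ℤ` (equivalently over `𝔽_p`). [folklore] -/
theorem hasResolution_Spec_of_finiteType_int_of_perfect (C : Type) [CommRing C] [IsReduced C]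
    [CharP C p] [Algebra.FiniteType ℤ C] : Scheme.HasResolution (Spec (.of C)) := by
  letI : Algebra (ZMod p) C := ZMod.algebra C p
  haveI : Algebra.FiniteType (ZMod p) C :=
    Algebra.FiniteType.of_restrictScalars_finiteType ℤ (ZMod p) C
  let f : Spec (.of C) ⟶ Spec (.of (ZMod p)) :=
    Spec.map (CommRingCat.ofHom (algebraMap (ZMod p) C))
  haveI : LocallyOfFiniteType f :=
    (HasRingHomProperty.Spec_iff (P := @LocallyOfFiniteType)).mpr
      (RingHom.finiteType_algebraMap.mpr ‹_›)
  exact hP (ZMod p) (Spec (.of C)) f inferInstance inferInstance inferInstance inferInstance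

/-- **… and every integral affine scheme essentially of finite type over `𝔽_p`** (spread out
and localize, `hasResolution_Spec_of_essFiniteType`): under `hP`, `Spec B`
has a resolution for every domain `B` of characteristic `p` essentially of finite type over `ℤ`
— e.g. every domain of finite type over a finitely generated field of characteristic `p`.
[folklore] -/
theorem hasResolution_Spec_of_essFiniteType_int_of_perfect (B : Type) [CommRing B] [IsDomain B]
    [CharP B p] [Algebra.EssFiniteType ℤ B] : Scheme.HasResolution (Spec (.of B)) := by
  refine hasResolution_Spec_of_essFiniteType ℤ B fun C hC => ?_
  haveI : CharP C p := RingHom.charP (algebraMap C B) Subtype.val_injective p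
  -- `hC` refers to the subalgebra's `ℤ`-algebra structure; move it to the canonical one
  -- (`Algebra ℤ _` is a subsingleton)
  have e : C.algebra = Ring.toIntAlgebra C := Subsingleton.elim _ _
  haveI : @Algebra.FiniteType ℤ C _ _ (Ring.toIntAlgebra C) := by rw [← e]; exact hC
  exact hasResolution_Spec_of_finiteType_int_of_perfect hP C

/-- **The local model over a base essentially of finite type over `𝔽_p`**: under `hP`
(resolution over perfect fields of characteristic `p`), for every domain `R` of characteristic
`p` essentially of finite type over `ℤ` and every `a ∈ R`, the reduced local model
`Spec ((R[T]/(T^p - a))_red)` — a domain, finite over `R` — has a resolution. (Regularity of `R`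
is not used.) [folklore] -/
theorem hasResolution_localModel_of_perfect_of_essFiniteType {R : Type} [CommRing R] [IsDomain R]
    [CharP R p] [Algebra.EssFiniteType ℤ R] (a : R) :
    Scheme.HasResolution (Spec (.of
      (AdjoinRoot (X ^ p - C a) ⧸ nilradical (AdjoinRoot (X ^ p - C a))))) := by
  haveI := isDomain_adjoinRoot_X_pow_sub_C_quotient_nilradical (p := p) a
  haveI : CharP (AdjoinRoot (X ^ p - C a) ⧸ nilradical (AdjoinRoot (X ^ p - C a))) p :=
    charP_of_injective_ringHom (algebraMap_quotient_nilradical_injective (p := p) a) p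
  haveI : Algebra.FiniteType R
      (AdjoinRoot (X ^ p - C a) ⧸ nilradical (AdjoinRoot (X ^ p - C a))) := inferInstance
  -- essentially of finite type over `ℤ`, for the canonical `ℤ`-algebra structure of the
  -- quotient (`Algebra ℤ _` is a subsingleton; the lemma below is stated for `Ring.toIntAlgebra`)
  have e : (inferInstance : Algebra ℤ
      (AdjoinRoot (X ^ p - C a) ⧸ nilradical (AdjoinRoot (X ^ p - C a)))) =
        Ring.toIntAlgebra _ := Subsingleton.elim _ _
  haveI : @Algebra.EssFiniteType ℤ
      (AdjoinRoot (X ^ p - C a) ⧸ nilradical (AdjoinRoot (X ^ p - C a))) _ _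
        (Ring.toIntAlgebra _) := by
    rw [← e]; exact Algebra.EssFiniteType.comp ℤ R _
  exact hasResolution_Spec_of_essFiniteType_int_of_perfect hP _

end PerfectPrimeField

/-! ## Corollaries in the binder form of the crux `PicoverLocalModel` -/

/-- **`PicoverLocalModel` over ground fields finitely generated over `𝔽_p`, from resolution over
perfect fields** (all primes, all dimensions): the crux statement with the extra hypotheses
(i) resolution of reduced separated finite-type schemes over perfect fields of characteristic `p`
(`DescentPerfectToAll`'s hypothesis / `WeightedThesis` at `p`; only `k = 𝔽_p` is used) and
(ii) the ground field `k` is essentially of finite type over `ℤ`, i.e. finitely generated over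
`𝔽_p` as a field (`𝔽_p(t₁,…,t_m)` and its finite extensions — imperfect in general). Proof:
`R`, hence the local model, is then essentially of finite type over `𝔽_p`; resolve a finite-type
model over `𝔽_p` and localize (`hasResolution_Spec_of_essFiniteType`). `IsRegularRing R` is not
used. The residual case of the crux is `k` imperfect and not finitely generated. [folklore] -/
theorem picoverLocalModel_of_perfect_of_essFiniteType :
    ∀ p : ℕ, p.Prime →
      (∀ (k : Type) [Field k] [CharP k p] [PerfectField k] (X : AlgebraicGeometry.Scheme.{0})
        (f : X ⟶ AlgebraicGeometry.Spec (.of k)), AlgebraicGeometry.IsSeparated f →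
        AlgebraicGeometry.LocallyOfFiniteType f → AlgebraicGeometry.QuasiCompact f →
        AlgebraicGeometry.IsReduced X →
        Literature.AlgebraicGeometry.Resolution.Scheme.HasResolution X) →
      ∀ (k : Type) [Field k] [CharP k p] (R : Type) [CommRing R] [IsDomain R]
      [Algebra k R], Algebra.FiniteType k R → IsRegularRing R → Algebra.EssFiniteType ℤ k →
      ∀ a : R, Literature.AlgebraicGeometry.Resolution.Scheme.HasResolution
        (AlgebraicGeometry.Spec (.of (AdjoinRoot (Polynomial.X ^ p - Polynomial.C a) ⧸
          nilradical (AdjoinRoot (Polynomial.X ^ p - Polynomial.C a))))) := by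
  intro p hp hP k _ _ R _ _ _ _ _ hk a
  haveI : Fact p.Prime := ⟨hp⟩
  haveI : CharP R p := charP_of_algebra_field k R
  haveI : Algebra.EssFiniteType k R := inferInstance
  haveI : Algebra.EssFiniteType ℤ R := Algebra.EssFiniteType.comp ℤ k R
  exact hasResolution_localModel_of_perfect_of_essFiniteType hP a

/-- **`PicoverLocalModel` over PERFECT ground fields, from resolution over perfect fields**
(trivial transfer: the local model is a reduced affine `k`-scheme of finite type). Together
with `picoverLocalModel_of_perfect_of_essFiniteType` this is what the perfect-field statements
give towards the crux without a descent argument. [folklore] -/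
theorem picoverLocalModel_of_perfect_of_perfectField :
    ∀ p : ℕ, p.Prime →
      (∀ (k : Type) [Field k] [CharP k p] [PerfectField k] (X : AlgebraicGeometry.Scheme.{0})
        (f : X ⟶ AlgebraicGeometry.Spec (.of k)), AlgebraicGeometry.IsSeparated f →
        AlgebraicGeometry.LocallyOfFiniteType f → AlgebraicGeometry.QuasiCompact f →
        AlgebraicGeometry.IsReduced X →
        Literature.AlgebraicGeometry.Resolution.Scheme.HasResolution X) →
      ∀ (k : Type) [Field k] [CharP k p] [PerfectField k] (R : Type) [CommRing R] [IsDomain R]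
      [Algebra k R], Algebra.FiniteType k R → IsRegularRing R →
      ∀ a : R, Literature.AlgebraicGeometry.Resolution.Scheme.HasResolution
        (AlgebraicGeometry.Spec (.of (AdjoinRoot (Polynomial.X ^ p - Polynomial.C a) ⧸
          nilradical (AdjoinRoot (Polynomial.X ^ p - Polynomial.C a))))) := by
  intro p hp hP k _ _ _ R _ _ _ _ _ a
  haveI : Fact p.Prime := ⟨hp⟩
  haveI := isReduced_adjoinRoot_X_pow_sub_C_quotient_nilradical (p := p) a
  haveI : Algebra.FiniteType k
      (AdjoinRoot (X ^ p - C a) ⧸ nilradical (AdjoinRoot (X ^ p - C a))) := inferInstance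
  let f : Spec (.of (AdjoinRoot (X ^ p - C a) ⧸ nilradical (AdjoinRoot (X ^ p - C a)))) ⟶
      Spec (.of k) := Spec.map (CommRingCat.ofHom (algebraMap k _))
  haveI : LocallyOfFiniteType f :=
    (HasRingHomProperty.Spec_iff (P := @LocallyOfFiniteType)).mpr
      (RingHom.finiteType_algebraMap.mpr ‹_›)
  exact hP k _ f inferInstance inferInstance inferInstance inferInstance

end Summit.ResolutionOfSingularities.ResolutionOfSingularities.Theorems
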